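import Mathlib.Analysis.SpecialFunctions.Pow.Real
import Mathlib.Analysis.SpecialFunctions.Log.Basic
import Mathlib.Analysis.Complex.ExponentialBounds
import HarnessLib

/-!
# [IUTchIV] Corollary 2.2 (ii) (Construction of Suitable Initial Θ-Data): the arithmetic from the
# display of Theorem 1.10 to the inequality (C2)

Mochizuki, *Inter-universal Teichmüller theory IV*, RIMS manuscript (Apr. 2020; = PRIMS **57** (2021)),
Corollary 2.2, statement pp. 41–43, proof pp. 43–48; this file kernel-checks the REAL ARITHMETIC of the
proof of (ii) from the point "In light of (P7), we may apply Theorem 1.10 … to conclude that" (p. 46) to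
"we conclude that both of the conditions (C1), (C2) … hold for `C_K` as defined above" (p. 48). TAKES NO
SIDE on the disputed step: the display of Theorem 1.10 enters as a HYPOTHESIS (`disp` below; Theorem 1.10
itself rests on [IUTchIII] Cor. 3.12), and nothing is asserted about any elliptic curve.

Setting (pp. 44–47). `h := log(q^∀) (≥ 1)`; we write `s := h^{1/2}` (so `h = s²`; the proof has arranged
`h^{1/2} ≥ ξ_prm ≥ 5`); `δ := 2^12·3^3·5·d (≥ 2)`; `l` the prime of (P1): "`(5 ≤) h^{1/2} ≤ l ≤ 10δ·h^{1/2}·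
log(2δ·h) (≤ 20·δ²·h²)`"; `L := log(𝔡^{F_tpd}) + log(𝔣^{F_tpd}) ≥ 0`; `η_prm`; `B_K` the bound of "the
difference `(1/6)·log(q^∀) − (1/6)·log(q^{∤2})`" (from (i)); `ε_E := (60δ)²·h^{−1/2}·log(2δ·h)`;
`C_K := 40η_prm + 2B_K`.

INPUTS (hypotheses, each a printed statement with its source):
* `disp` — the first display of Theorem 1.10 as applied on p. 46: `(1/6)·log(q) ≤ (1 + 20·d_mod/l)·L +
  20·(e*_mod·l + η_prm)` with "`20·d_mod ≤ d*_mod ≤ δ`" and `e*_mod ≤ d*_mod ≤ δ` (`d_mod ≤ d`, p. 55);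
* `P1lo`, `P1hi` — (P1), p. 45 (from Prop. 2.1 and [GenEll]);
* `Q1` — "`(1/6)·log(q^{∤2}) − (1/6)·log(q) ≤ (1/6)·h^{1/2}·log(l)`" (p. 47, "from (P3), together with the
  computation of the discussion preceding (P5)");
* `Q2` — "`(1/6)·log(q^∀) − (1/6)·log(q^{∤2})` is bounded by some positive real number `B_K`" (p. 47, from (i)).

PROVED (namespace `Literature.IUT.LogVolume.Cor22`): the p. 45 chain `h^{1/2}·log(l) ≤ … ≤ 16·δ^{1/4}·h^{3/4}`
is not needed for (C2) and is omitted; `l ≤ 20·δ²·h²` (`l_le`); p. 46 `… ≤ (1 + δ·h^{−1/2})·L + 200·δ²·h^{1/2}·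
log(2δ·h) + 20η_prm` (`step_p46`); p. 47 `(1/6)·log(q^{∤2}) − (1/6)·log(q) ≤ h^{1/2}·log(2δ·h)` (`step_p47_q2`)
and `(1/6)·h ≤ (1 + δ·h^{−1/2})·L + (15δ)²·h^{1/2}·log(2δ·h) + (1/2)·C_K ≤ (1 + δ·h^{−1/2})·L + (1/6)·h·(2/5)·
(60δ)²·h^{−1/2}·log(2δ·h) + (1/2)·C_K` (`step_p47_h`); `ε_E ≥ 5·δ·h^{−1/2}` (`five_delta_le_epsE`); p. 48
"`(1/6)·h ≤ (1 − (2/5)·ε_E)⁻¹(1 + (1/5)·ε_E)·L + (1 − (2/5)·ε_E)⁻¹·(1/2)·C_K ≤ (1 + ε_E)·L + C_K`" for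
`ε_E ≤ 1` (`h_le_of_epsE_le_one`); and the assembled (C2): `(1/6)·log(q) ≤ (1/6)·log(q^{∤2}) ≤ (1/6)·log(q^∀)
≤ (1 + ε_E)·(log-diff_X(x_E) + log-cond_D(x_E)) + C_K` given "`log-diff_X(x_E) = log(𝔡^{F_tpd})`,
`log(𝔣^{F_tpd}) ≤ log-cond_D(x_E)`" (`condition_C2`). Also the exceptional-set bound of p. 47: `1 < ε_E ⟹
h < (16/ε_d)³·(60δ)^{4+ε_d}` for `0 < ε_d ≤ 1` (`h_lt_of_one_lt_epsE`), i.e. the shape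
"`H_unif·ε_d^{−3}·d^{4+ε_d}`" of the statement of (ii).

Deliberately NOT here: the construction of the initial Θ-data ((P1)–(P7): Prop. 2.1, [GenEll] §3, Prop.
1.8), the BD-class statements of (i), the finite sets `Exc_d`, condition (C1) (which is (P1) itself).
-/

noncomputable section

namespace Literature.IUT.LogVolume

namespace Cor22

open Real

/-- `ε_E := (60δ)²·h^{−1/2}·log(2δ·h)` (p. 47), written with `s = h^{1/2}`, `h = s²`.
[claim: Mochizuki2012, status: disputed] -/
def epsE (δ s : ℝ) : ℝ := (60 * δ) ^ 2 / s * Real.log (2 * δ * s ^ 2)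

/-- `C_K := 40η_prm + 2B_K` (p. 47). [claim: Mochizuki2012, status: disputed] -/
def CK (η B : ℝ) : ℝ := 40 * η + 2 * B

/-- The hypotheses of the arithmetic part of the proof of Cor. 2.2 (ii) (pp. 45–47), for one elliptic
curve `E_F`: the reals `s = h^{1/2}` (`h = log(q^∀)`), `δ`, `l`, `L = log(𝔡^{F_tpd}) + log(𝔣^{F_tpd})`,
`η_prm`, `B_K`, `log(q)`, `log(q^{∤2})`, `d_mod`, `e*_mod`, with the printed inequalities they satisfy.
[claim: Mochizuki2012, status: disputed] -/
structure Data where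
  /-- `s := h^{1/2}`, `h := log(q^∀)` -/
  s : ℝ
  /-- `h^{1/2} ≥ ξ_prm ≥ 5` (p. 44) -/
  five_le_s : 5 ≤ s
  /-- `δ := 2^12·3^3·5·d` -/
  δ : ℝ
  /-- "`δ ≥ 2`" (p. 45; indeed `δ ≥ 552960`) -/
  two_le_δ : 2 ≤ δ
  /-- the prime `l` of (P1) -/
  l : ℝ
  /-- (P1), lower: `h^{1/2} ≤ l` (p. 45) -/
  P1lo : s ≤ l
  /-- (P1), upper: `l ≤ 10δ·h^{1/2}·log(2δ·h)` (p. 45) -/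
  P1hi : l ≤ 10 * δ * s * Real.log (2 * δ * s ^ 2)
  /-- `L := log(𝔡^{F_tpd}) + log(𝔣^{F_tpd})` -/
  L : ℝ
  /-- `L ≥ 0` -/
  L_nonneg : 0 ≤ L
  /-- `η_prm` -/
  η : ℝ
  /-- `η_prm ≥ 0` -/
  η_nonneg : 0 ≤ η
  /-- `B_K` -/
  B : ℝ
  /-- "some positive real number `B_K`" (p. 47) -/
  B_nonneg : 0 ≤ B
  /-- `log(q)` of Theorem 1.10 (`q`-parameters at `𝕍^bad_mod`, primes not dividing `2l`) -/
  logq : ℝ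
  /-- `log(q^{∤2})` -/
  logq2 : ℝ
  /-- `d_mod` -/
  dmod : ℝ
  /-- `d_mod ≥ 0` -/
  dmod_nonneg : 0 ≤ dmod
  /-- "`20·d_mod ≤ d*_mod ≤ δ`" (p. 47) -/
  twenty_dmod_le : 20 * dmod ≤ δ
  /-- `e*_mod` -/
  estar : ℝ
  /-- `e*_mod ≥ 0` -/
  estar_nonneg : 0 ≤ estar
  /-- `e*_mod ≤ d*_mod ≤ δ` (p. 22: `e*_mod ≤ d*_mod`; p. 55: `d_mod ≤ d`) -/
  estar_le : estar ≤ δ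
  /-- Theorem 1.10, first display, as applied on p. 46 ("In light of (P7), we may apply Theorem 1.10"):
  `(1/6)·log(q) ≤ (1 + 20·d_mod/l)·L + 20·(e*_mod·l + η_prm)`. INPUT (source: Thm 1.10, which rests on
  [IUTchIII] Cor. 3.12). -/
  disp : 1 / 6 * logq ≤ (1 + 20 * dmod / l) * L + 20 * (estar * l + η)
  /-- p. 47: "`(1/6)·log(q^{∤2}) − (1/6)·log(q) ≤ (1/6)·h^{1/2}·log(l)`". INPUT (source: (P3), definition of
  `h`). -/
  Q1 : 1 / 6 * logq2 - 1 / 6 * logq ≤ 1 / 6 * s * Real.log l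
  /-- p. 47: "the difference `(1/6)·log(q^∀) − (1/6)·log(q^{∤2})` is bounded by … `B_K`". INPUT (source:
  Cor. 2.2 (i)). -/
  Q2 : 1 / 6 * s ^ 2 - 1 / 6 * logq2 ≤ B

namespace Data

variable (A : Data)

/-- `h := s² = log(q^∀)`. [claim: Mochizuki2012, status: disputed] -/
def h : ℝ := A.s ^ 2

/-! ### Elementary consequences of the ranges -/

/-- `s > 0`. [folklore] -/
private theorem s_pos : 0 < A.s := by linarith [A.five_le_s]

/-- `δ > 0`. [folklore] -/
private theorem delta_pos : 0 < A.δ := by linarith [A.two_le_δ]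

/-- `l > 0`. [folklore] -/
private theorem l_pos : 0 < A.l := by linarith [A.five_le_s, A.P1lo]

/-- `h = s² ≥ 1` ("`1 ≤ h`", p. 47). [folklore] -/
private theorem one_le_h : 1 ≤ A.s ^ 2 := by nlinarith [A.five_le_s]

/-- "`log(2δ·h) ≥ log(2δ) ≥ log(4) ≥ 1`" (p. 47). [claim: Mochizuki2012, status: disputed] -/
theorem one_le_log : 1 ≤ Real.log (2 * A.δ * A.s ^ 2) := by
  have h4 : (4 : ℝ) ≤ 2 * A.δ * A.s ^ 2 := by nlinarith [A.two_le_δ, A.one_le_h, A.delta_pos]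
  have he : Real.exp 1 ≤ 4 := by
    have := Real.exp_one_lt_d9; linarith
  calc (1 : ℝ) = Real.log (Real.exp 1) := (Real.log_exp 1).symm
    _ ≤ Real.log 4 := Real.log_le_log (Real.exp_pos 1) he
    _ ≤ Real.log (2 * A.δ * A.s ^ 2) := Real.log_le_log (by norm_num) h4

/-- `ε_E > 0`. [claim: Mochizuki2012, status: disputed] -/
theorem epsE_pos : 0 < epsE A.δ A.s := by
  unfold epsE
  have := A.one_le_log; have := A.s_pos; have := A.delta_pos
  positivity

/-- (P1) gives "`l ≤ 20·δ²·h²`" (p. 45), via `log(2δh) ≤ 2δh` (Prop. 2.1 (i)) and `h ≥ 1`.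
[claim: Mochizuki2012, status: disputed] -/
theorem l_le : A.l ≤ 20 * A.δ ^ 2 * (A.s ^ 2) ^ 2 := by
  have h1 := A.P1hi
  have hlog : Real.log (2 * A.δ * A.s ^ 2) ≤ 2 * A.δ * A.s ^ 2 := Real.log_le_self (by
    have := A.delta_pos; positivity)
  have hs := A.s_pos; have hδ := A.delta_pos; have h5 := A.five_le_s
  have : 10 * A.δ * A.s * Real.log (2 * A.δ * A.s ^ 2) ≤ 10 * A.δ * A.s * (2 * A.δ * A.s ^ 2) :=
    mul_le_mul_of_nonneg_left hlog (by positivity)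
  have hs1 : A.s ≤ A.s ^ 2 := by nlinarith
  nlinarith [mul_le_mul_of_nonneg_left hs1 (show (0:ℝ) ≤ 20 * A.δ ^ 2 * A.s ^ 2 by positivity)]

/-! ### p. 46: applying Theorem 1.10 -/

/-- p. 46: "`(1/6)·log(q) ≤ (1 + 20·d_mod/l)·L + 20·(d*_mod·l + η_prm) ≤ (1 + δ·h^{−1/2})·L + 200·δ²·h^{1/2}·
log(2δ·h) + 20η_prm` — where we apply (P1), as well as the estimates `20·d_mod ≤ d*_mod ≤ δ`."
[claim: Mochizuki2012, status: disputed] -/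
theorem step_p46 : 1 / 6 * A.logq ≤
    (1 + A.δ / A.s) * A.L + 200 * A.δ ^ 2 * A.s * Real.log (2 * A.δ * A.s ^ 2) + 20 * A.η := by
  have hd := A.disp
  have hs := A.s_pos; have hl := A.l_pos; have hδ := A.delta_pos
  -- `20 d_mod / l ≤ δ / l ≤ δ / s`
  have h1 : 20 * A.dmod / A.l ≤ A.δ / A.s := by
    calc 20 * A.dmod / A.l ≤ A.δ / A.l := div_le_div_of_nonneg_right A.twenty_dmod_le hl.le
      _ ≤ A.δ / A.s := div_le_div_of_nonneg_left hδ.le hs A.P1lo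
  have h2 : (1 + 20 * A.dmod / A.l) * A.L ≤ (1 + A.δ / A.s) * A.L :=
    mul_le_mul_of_nonneg_right (by linarith) A.L_nonneg
  -- `20 e* l ≤ 20 δ · 10δ s log(2δh)`
  have hlog := A.one_le_log
  have h3 : A.estar * A.l ≤ A.δ * (10 * A.δ * A.s * Real.log (2 * A.δ * A.s ^ 2)) :=
    mul_le_mul A.estar_le A.P1hi hl.le hδ.le
  nlinarith

/-! ### p. 47 -/

/-- p. 47: "`(1/6)·log(q^{∤2}) − (1/6)·log(q) ≤ (1/6)·h^{1/2}·log(l) ≤ (1/3)·h^{1/2}·log(5δ·h) ≤ h^{1/2}·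
log(2δ·h)` — where we apply the estimates `1 ≤ h` and `5 ≤ 2³`" (and `l ≤ 20·δ²·h² ≤ (5δ·h)²`, p. 45).
[claim: Mochizuki2012, status: disputed] -/
theorem step_p47_q2 : 1 / 6 * A.logq2 - 1 / 6 * A.logq ≤ A.s * Real.log (2 * A.δ * A.s ^ 2) := by
  have hQ := A.Q1
  have hs := A.s_pos; have hl := A.l_pos; have hδ := A.delta_pos; have h1 := A.one_le_h
  -- `log l ≤ log(20 δ² h²) ≤ log((5δh)²) = 2 log(5δh)`
  have hl2 : Real.log A.l ≤ 2 * Real.log (5 * A.δ * A.s ^ 2) := by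
    have e : 2 * Real.log (5 * A.δ * A.s ^ 2) = Real.log ((5 * A.δ * A.s ^ 2) ^ 2) := by
      rw [Real.log_pow]; norm_num
    rw [e]
    apply Real.log_le_log hl
    have := A.l_le
    nlinarith
  -- `(1/3) log(5δh) ≤ log(2δh)`, i.e. `5δh ≤ (2δh)³`
  have hl3 : Real.log (5 * A.δ * A.s ^ 2) ≤ 3 * Real.log (2 * A.δ * A.s ^ 2) := by
    have e : 3 * Real.log (2 * A.δ * A.s ^ 2) = Real.log ((2 * A.δ * A.s ^ 2) ^ 3) := by
      rw [Real.log_pow]; norm_num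
    rw [e]
    apply Real.log_le_log (by positivity)
    have hx : 2 ≤ A.δ * A.s ^ 2 := by nlinarith [A.two_le_δ]
    have hx2 : 4 ≤ (A.δ * A.s ^ 2) ^ 2 := by nlinarith
    have e3 : (2 * A.δ * A.s ^ 2) ^ 3 = 8 * ((A.δ * A.s ^ 2) * (A.δ * A.s ^ 2) ^ 2) := by ring
    rw [e3]
    nlinarith [mul_le_mul_of_nonneg_left hx2 (show (0 : ℝ) ≤ A.δ * A.s ^ 2 by positivity)]
  have : 1 / 6 * A.s * Real.log A.l ≤ A.s * Real.log (2 * A.δ * A.s ^ 2) := by nlinarith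
  linarith

/-- p. 47: "`(1/6)·h = (1/6)·log(q^∀) ≤ (1 + δ·h^{−1/2})·L + (15δ)²·h^{1/2}·log(2δ·h) + (1/2)·C_K ≤ (1 + δ·h^{−1/2})·L
+ (1/6)·h·(2/5)·(60δ)²·h^{−1/2}·log(2δ·h) + (1/2)·C_K` — where we write `C_K := 40η_prm + 2B_K`, and we apply
the estimate `6·5 ≤ 2·4²`." [claim: Mochizuki2012, status: disputed] -/
theorem step_p47_h :
    1 / 6 * A.s ^ 2 ≤ (1 + A.δ / A.s) * A.L + (15 * A.δ) ^ 2 * A.s * Real.log (2 * A.δ * A.s ^ 2)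
        + 1 / 2 * CK A.η A.B ∧
    (1 + A.δ / A.s) * A.L + (15 * A.δ) ^ 2 * A.s * Real.log (2 * A.δ * A.s ^ 2) + 1 / 2 * CK A.η A.B ≤
      (1 + A.δ / A.s) * A.L + 1 / 6 * A.s ^ 2 * (2 / 5 * epsE A.δ A.s) + 1 / 2 * CK A.η A.B := by
  have h46 := A.step_p46
  have h47 := A.step_p47_q2
  have hQ2 := A.Q2
  have hs := A.s_pos; have hδ := A.delta_pos; have hlog := A.one_le_log; have h2 := A.two_le_δ
  have hsl : 0 ≤ A.s * Real.log (2 * A.δ * A.s ^ 2) := by positivity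
  constructor
  · -- `200 δ² + 1 ≤ 225 δ² = (15δ)²` since `δ ≥ 2`
    unfold CK
    have e1 : (15 * A.δ) ^ 2 * A.s * Real.log (2 * A.δ * A.s ^ 2) =
        225 * A.δ ^ 2 * (A.s * Real.log (2 * A.δ * A.s ^ 2)) := by ring
    have e2 : 200 * A.δ ^ 2 * A.s * Real.log (2 * A.δ * A.s ^ 2) =
        200 * A.δ ^ 2 * (A.s * Real.log (2 * A.δ * A.s ^ 2)) := by ring
    have h25 : (1 : ℝ) * (A.s * Real.log (2 * A.δ * A.s ^ 2)) ≤
        25 * A.δ ^ 2 * (A.s * Real.log (2 * A.δ * A.s ^ 2)) :=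
      mul_le_mul_of_nonneg_right (by nlinarith) hsl
    have hδ2 : 0 ≤ A.δ ^ 2 * (A.s * Real.log (2 * A.δ * A.s ^ 2)) := by positivity
    linarith
  · -- `(15δ)² s log = 225 δ² s log ≤ (1/6) s² (2/5) (60δ)²/s log = 240 δ² s log`
    have e : 1 / 6 * A.s ^ 2 * (2 / 5 * epsE A.δ A.s) =
        240 * A.δ ^ 2 * (A.s * Real.log (2 * A.δ * A.s ^ 2)) := by
      unfold epsE; field_simp; ring
    have e1 : (15 * A.δ) ^ 2 * A.s * Real.log (2 * A.δ * A.s ^ 2) =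
        225 * A.δ ^ 2 * (A.s * Real.log (2 * A.δ * A.s ^ 2)) := by ring
    rw [e, e1]
    have hδ2 : 0 ≤ A.δ ^ 2 * (A.s * Real.log (2 * A.δ * A.s ^ 2)) := by positivity
    linarith

/-- p. 47: "`ε_E := (60δ)²·h^{−1/2}·log(2δ·h) (≥ 5·δ·h^{−1/2})`". [claim: Mochizuki2012, status: disputed] -/
theorem five_delta_le_epsE : 5 * A.δ / A.s ≤ epsE A.δ A.s := by
  unfold epsE
  have hs := A.s_pos; have hδ := A.delta_pos; have hlog := A.one_le_log
  rw [div_le_iff₀ hs]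
  have e : (60 * A.δ) ^ 2 / A.s * Real.log (2 * A.δ * A.s ^ 2) * A.s =
      3600 * A.δ ^ 2 * Real.log (2 * A.δ * A.s ^ 2) := by field_simp; ring
  rw [e]
  nlinarith [A.two_le_δ]

/-! ### p. 48: the conclusion for `ε_E ≤ 1` -/

/-- **p. 47–48**: if `ε_E ≤ 1` then "`(1/6)·h ≤ (1 − (2/5)·ε_E)⁻¹(1 + (1/5)·ε_E)·L + (1 − (2/5)·ε_E)⁻¹·(1/2)·C_K
≤ (1 + ε_E)·L + C_K` by applying the estimates `(1 + (1/5)·ε_E)/(1 − (2/5)·ε_E) ≤ 1 + ε_E`; `1 − (2/5)·ε_E ≥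
1/2` — both of which are consequences of the fact that `0 < ε_E ≤ 1`" (using `δ·h^{−1/2} ≤ (1/5)·ε_E`).
[claim: Mochizuki2012, status: disputed] -/
theorem h_le_of_epsE_le_one (hε : epsE A.δ A.s ≤ 1) :
    1 / 6 * A.s ^ 2 ≤ (1 + epsE A.δ A.s) * A.L + CK A.η A.B := by
  obtain ⟨h1, h2⟩ := A.step_p47_h
  have h3 := A.five_delta_le_epsE
  have hε0 := A.epsE_pos
  have hL := A.L_nonneg
  have hs := A.s_pos
  set ε := epsE A.δ A.s with hεdef
  -- `(1/6) h (1 − (2/5) ε) ≤ (1 + ε/5) L + C_K/2`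
  have hδs : A.δ / A.s ≤ 1 / 5 * ε := by
    have : 5 * A.δ / A.s = 5 * (A.δ / A.s) := by ring
    linarith
  have hmain : 1 / 6 * A.s ^ 2 * (1 - 2 / 5 * ε) ≤ (1 + 1 / 5 * ε) * A.L + 1 / 2 * CK A.η A.B := by
    have := mul_le_mul_of_nonneg_right hδs hL
    nlinarith
  have hC : 0 ≤ CK A.η A.B := by unfold CK; have := A.η_nonneg; have := A.B_nonneg; positivity
  have hden : 1 / 2 ≤ 1 - 2 / 5 * ε := by linarith
  -- `(1 + ε/5) ≤ (1+ε)(1 − 2ε/5)` and `1/2 ≤ 1 − 2ε/5`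
  have hc1 : (1 + 1 / 5 * ε) * A.L ≤ (1 + ε) * (1 - 2 / 5 * ε) * A.L := by
    apply mul_le_mul_of_nonneg_right _ hL; nlinarith
  have hc2 : 1 / 2 * CK A.η A.B ≤ (1 - 2 / 5 * ε) * CK A.η A.B := mul_le_mul_of_nonneg_right hden hC
  have : 1 / 6 * A.s ^ 2 * (1 - 2 / 5 * ε) ≤ ((1 + ε) * A.L + CK A.η A.B) * (1 - 2 / 5 * ε) := by
    nlinarith
  exact le_of_mul_le_mul_right this (by linarith)

/-- **Condition (C2) of Corollary 2.2 (ii), assembled (p. 48)**: with `log(q) ≤ log(q^{∤2}) ≤ log(q^∀) = h`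
(the three divisors are successively larger), "`log-diff_X(x_E) = log(𝔡^{F_tpd})`" and "`log(𝔣^{F_tpd}) ≤
log-cond_D(x_E)`" (p. 43/48), and `ε_E ≤ 1`: `(1/6)·log(q) ≤ (1/6)·log(q^{∤2}) ≤ (1/6)·log(q^∀) ≤ (1 + ε_E)·
(log-diff_X(x_E) + log-cond_D(x_E)) + C_K`. [claim: Mochizuki2012, status: disputed] -/
theorem condition_C2 (hε : epsE A.δ A.s ≤ 1) {logDiffTpd logCondTpd logdiff logcond : ℝ}
    (hL : A.L = logDiffTpd + logCondTpd) (hdiff : logdiff = logDiffTpd) (hcond : logCondTpd ≤ logcond)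
    (hq1 : A.logq ≤ A.logq2) (hq2 : A.logq2 ≤ A.s ^ 2) :
    1 / 6 * A.logq ≤ 1 / 6 * A.logq2 ∧ 1 / 6 * A.logq2 ≤ 1 / 6 * A.s ^ 2 ∧
      1 / 6 * A.s ^ 2 ≤ (1 + epsE A.δ A.s) * (logdiff + logcond) + CK A.η A.B := by
  have hm := A.h_le_of_epsE_le_one hε
  have hε0 := A.epsE_pos
  refine ⟨by linarith, by linarith, ?_⟩
  have : A.L ≤ logdiff + logcond := by rw [hL, hdiff]; linarith
  have := mul_le_mul_of_nonneg_left this (show 0 ≤ 1 + epsE A.δ A.s by linarith)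
  linarith

/-! ### p. 47: `ε_E > 1` bounds `h` (the exceptional set) -/

/-- p. 47: for `0 < ε_d ≤ 1`, `ε*_d := ε_d/16`, "the inequality `1 < ε_E = … ≤ (ε*_d)⁻¹·(60δ)^{2+ε*_d}·
h^{−(1/2−ε*_d)} ≤ {(ε*_d)^{−3}·(60δ)^{4+ε_d}·h^{−1}}^{(1/2−ε*_d)}` … implies a bound on `h`": namely
`h < (16/ε_d)³·(60δ)^{4+ε_d}` — the shape `H_unif·ε_d^{−3}·d^{4+ε_d}` of the statement of (ii).
[claim: Mochizuki2012, status: disputed] -/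
theorem h_lt_of_one_lt_epsE (hε : 1 < epsE A.δ A.s) {εd : ℝ} (hεd0 : 0 < εd) (hεd1 : εd ≤ 1) :
    A.s ^ 2 < (16 / εd) ^ (3 : ℝ) * (60 * A.δ) ^ (4 + εd) := by
  have hs := A.s_pos; have hδ := A.delta_pos; have h2 := A.two_le_δ
  set e : ℝ := εd / 16 with hedef
  have he0 : 0 < e := by rw [hedef]; positivity
  have he1 : e ≤ 1 / 16 := by rw [hedef]; linarith
  set h : ℝ := A.s ^ 2 with hhdef
  have hh1 : 1 ≤ h := A.one_le_h
  have hh0 : 0 < h := by positivity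
  have h60 : (1 : ℝ) ≤ 60 * A.δ := by linarith
  -- Step 1: `log(2δh) ≤ (2δh)^e / e ≤ (60δ)^e · h^e / e`
  have hlog : Real.log (2 * A.δ * h) ≤ (60 * A.δ) ^ e * h ^ e / e := by
    have h1 : Real.log (2 * A.δ * h) ≤ (2 * A.δ * h) ^ e / e :=
      Real.log_le_rpow_div (by positivity) he0
    have h2 : (2 * A.δ * h) ^ e ≤ (60 * A.δ * h) ^ e :=
      Real.rpow_le_rpow (by positivity) (by nlinarith) he0.le
    have h3 : (60 * A.δ * h) ^ e = (60 * A.δ) ^ e * h ^ e := Real.mul_rpow (by positivity) hh0.le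
    have := div_le_div_of_nonneg_right (h2.trans_eq h3) he0.le
    linarith
  -- Step 2: `ε_E ≤ (1/e)·(60δ)^{2+e}·h^{e − 1/2}`
  have hsh : A.s = h ^ (1 / 2 : ℝ) := by
    rw [hhdef, ← Real.sqrt_eq_rpow, Real.sqrt_sq hs.le]
  have hεle : epsE A.δ A.s ≤ 1 / e * (60 * A.δ) ^ (2 + e) * h ^ (e - 1 / 2) := by
    unfold epsE
    rw [show A.s ^ 2 = h from rfl]
    have hpos : 0 ≤ (60 * A.δ) ^ 2 / A.s := by positivity
    calc (60 * A.δ) ^ 2 / A.s * Real.log (2 * A.δ * h)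
        ≤ (60 * A.δ) ^ 2 / A.s * ((60 * A.δ) ^ e * h ^ e / e) := mul_le_mul_of_nonneg_left hlog hpos
      _ = 1 / e * ((60 * A.δ) ^ (2 : ℝ) * (60 * A.δ) ^ e) * (h ^ e / A.s) := by
          rw [← Real.rpow_natCast]; push_cast; ring
      _ = 1 / e * (60 * A.δ) ^ (2 + e) * (h ^ e / h ^ (1 / 2 : ℝ)) := by
          rw [← Real.rpow_add (by positivity), hsh]
      _ = 1 / e * (60 * A.δ) ^ (2 + e) * h ^ (e - 1 / 2) := by
          rw [← Real.rpow_sub hh0]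
  -- Step 3: `1 < ε_E` gives `h^{1/2 − e} < (1/e)·(60δ)^{2+e}`
  have hexp : 0 < 1 / 2 - e := by linarith
  have hK : h ^ (1 / 2 - e) < 1 / e * (60 * A.δ) ^ (2 + e) := by
    have h1 : 1 < 1 / e * (60 * A.δ) ^ (2 + e) * h ^ (e - 1 / 2) := lt_of_lt_of_le hε hεle
    have h2 : h ^ (1 / 2 - e) * h ^ (e - 1 / 2) = 1 := by
      rw [← Real.rpow_add hh0]; norm_num
    have h3 : 0 < h ^ (1 / 2 - e) := Real.rpow_pos_of_pos hh0 _
    have h4 : 0 < h ^ (e - 1 / 2) := Real.rpow_pos_of_pos hh0 _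
    nlinarith
  -- Step 4: raise to the power `1/(1/2 − e) ≤ 3`, with exponent bounds
  set K : ℝ := 1 / e * (60 * A.δ) ^ (2 + e) with hKdef
  have hK1 : 1 ≤ K := by
    have a : (1 : ℝ) ≤ 1 / e := by rw [le_div_iff₀ he0]; linarith
    have b : (1 : ℝ) ≤ (60 * A.δ) ^ (2 + e) := Real.one_le_rpow h60 (by linarith)
    rw [hKdef]; nlinarith
  have hhlt : h < K ^ (1 / (1 / 2 - e)) := by
    have := Real.rpow_lt_rpow (Real.rpow_nonneg hh0.le _) hK (show 0 < 1 / (1 / 2 - e) by positivity)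
    rwa [← Real.rpow_mul hh0.le, mul_one_div_cancel hexp.ne', Real.rpow_one] at this
  -- `K^{1/(1/2−e)} = (1/e)^{1/(1/2−e)} · (60δ)^{(2+e)/(1/2−e)} ≤ (1/e)³ · (60δ)^{4+ε_d}`
  have hexp1 : 1 / (1 / 2 - e) ≤ 3 := by
    rw [div_le_iff₀ hexp]; linarith
  have hexp2 : (2 + e) * (1 / (1 / 2 - e)) ≤ 4 + εd := by
    rw [← mul_div_assoc, mul_one, div_le_iff₀ hexp, hedef]; nlinarith
  have hKpow : K ^ (1 / (1 / 2 - e)) ≤ (1 / e) ^ (3 : ℝ) * (60 * A.δ) ^ (4 + εd) := by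
    rw [hKdef, Real.mul_rpow (by positivity) (Real.rpow_nonneg (by positivity) _), ← Real.rpow_mul
      (by positivity)]
    apply mul_le_mul
    · exact Real.rpow_le_rpow_of_exponent_le (by rw [le_div_iff₀ he0]; linarith) hexp1
    · exact Real.rpow_le_rpow_of_exponent_le h60 hexp2
    · exact Real.rpow_nonneg (by positivity) _
    · exact Real.rpow_nonneg (by positivity) _
  have e16 : (1 / e : ℝ) = 16 / εd := by rw [hedef]; field_simp
  rw [e16] at hKpow
  exact lt_of_lt_of_le hhlt hKpow

end Data

end Cor22

end Literature.IUT.LogVolume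

end
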